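import Summits.HodgeConjecture.HodgeConjecture.Theorems.F0P3KitOfRecordW                  -- ★1 K0-W (F0P3a-p02 (g15)): `kitOfRecordW`, `kitOfRecordW_N`, `kitOfRecordW_sgnG`, `kitOfRecordW_sgnG_eq_one_or_eq_neg_one`
import Summits.HodgeConjecture.HodgeConjecture.Theorems.F0P3bLocalExpansionAtKitOfRecord   -- ★ ED. 1 (F0P3b-p01 (g6)): `GTraceProductForm`, `HTraceProductForm`, `localExpansion_kitOfRecord`
import HarnessLib

/-!
# Crux `H413` — closer ED. 38 «PK-ε», ★2: **(L6) `LocalExpansion` at the SIGNED kit of record `kitOfRecordW`**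

F0∕P3b desk INSTRUMENT (hodgecm-mathlib-F0P3b-plan (g20)) for the ★2 hand of record F0P3b-p01 (g13): the text of the ★2 file of RULING D53-pre A(4) ∕ P3b memo
b086a430ac19212c §3(c), cut against the ★1 report-first `F0P3KitOfRecordW.reportfirst.v1.F0P3ap02g15.lean` f68d6c51d6369ecd.  THEOREMS-SIDE, ADDITIVE: ★ ED. 1
`F0P3bLocalExpansionAtKitOfRecord` (cb3b6ba14e4599a8) and ★ K0 are untouched; `HTraceProductForm` is REUSED BY NAME (the sign lands on the G∕stable clause only).

THE MATHEMATICS (Rogawski 1990 Thm. 14.6.4 as corrected by Rogawski 1992 Thm. 1.2).  The stable (`G′`-side) summand of the two-term expansion (14.6.3) carries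
the global root number `W(ξ) = ε(½, φ_ξ) ∈ {±1}`: `Tr Π(ξ)_S(f_S) = [cpt]·(−1)^N·W(ξ)·(signed member products)`.  In the kit currency of ★ V6 this is the G-clause
`GTraceProductFormW … wXi …` := ★ ED. 1 `GTraceProductForm` with ONE factor `* (wXi ξ : ℂ)` right after `(-1) ^ nCompactOfRecord L`; at `𝔠₀^W = kitOfRecordW … wXi c …`
(`N ξ = N₀ + [wXi ξ = −1]`, `sgnG ξ = wXi ξ · c`) the two GAUGE IDENTITIES `(−1)^{N ξ} = (−1)^{N₀}·wXi ξ` and `(−1)^{N ξ}·sgnG ξ = (−1)^{N₀}·c` (for `wXi ξ = ±1`)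
turn (`GTraceProductFormW wXi`, `HTraceProductForm c`) into EXACTLY the product-form data of ★ V6 `localExpansion_of_productForm`, whence (L6) `LocalExpansion` at `𝔠₀^W`.
At `wXi ≡ 1` the clause is ★ ED. 1's (`gTraceProductFormW_one_iff`).  No `sorry`, no named fact, no instance, no notation; Theorems never import Lines;
`--supports stmt-HodgeConjecture-24833`.
HONEST LABEL: HC_CM is proved only modulo the printed citations until rung 0 closes; count-neutral support (re-threads the sign of row #181 «PK-tuple»).

References: [Rogawski1990] §14.6 Thm. 14.6.4, (14.6.3) p. 244 ll. 6–17; §13.1 13.1.3 (b) p. 199; §12.3 12.3.3 (b) p. 178; [Rogawski1992] J. D. Rogawski, *The multiplicity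
formula for A-packets*, in: The zeta functions of Picard modular surfaces (CRM, 1992) 395–419, Thm. 1.2 p. 397, §6 p. 417.
-/

set_option autoImplicit false
-- the mandated namespace = the module name (as ★1 `F0P3KitOfRecordW`; ★4∕★5 consume `F0P3bLocalExpansionAtKitOfRecordW.GTraceProductFormW` ∕ `.localExpansion_kitOfRecordW` BY NAME)
set_option linter.dupNamespace false

noncomputable section

open NumberField IsDedekindDomain MeasureTheory
open Literature.NumberTheory.Rogawski1990 Literature.NumberTheory.GaloisRepresentations
open Literature.NumberTheory.Automorphic Literature.NumberTheory.Automorphic.UnitaryGroup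
open scoped Matrix ComplexOrder BigOperators Classical

namespace Summit.HodgeConjecture.HodgeConjecture.Cruxes.H413.F0P3bLocalExpansionAtKitOfRecordW

open Summit.HodgeConjecture.HodgeConjecture.Cruxes.H413.F0P3InnerFormClassificationV6
open Summit.HodgeConjecture.HodgeConjecture.Cruxes.H413.F0P3InnerFormClassificationV6.ClassificationKit (memberCoeff)
open Summit.HodgeConjecture.HodgeConjecture.Cruxes.H413.F0P3SemilocalTestFunctionsOfRecord (TestS₀ chS₀ chS₀_def)
open Summit.HodgeConjecture.HodgeConjecture.Cruxes.H413.F0P3XiArchDataOfRecord (nCompactOfRecord)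
open Summit.HodgeConjecture.HodgeConjecture.Cruxes.H413.F0P3XiArchPacketOfRecord (archPacketOfRecord)
open Summit.HodgeConjecture.HodgeConjecture.Cruxes.H413.F0P3KitOfRecord (GHSide XiSide cptXi₀ kitOfRecord)
open Summit.HodgeConjecture.HodgeConjecture.Cruxes.H413.F0P3KitOfRecordW (kitOfRecordW kitOfRecordW_N kitOfRecordW_sgnG kitOfRecordW_sgnG_eq_one_or_eq_neg_one)
open Summit.HodgeConjecture.HodgeConjecture.Cruxes.H413.F0P3bLocalExpansionAtKitOfRecord (GTraceProductForm HTraceProductForm)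
open Summit.HodgeConjecture.HodgeConjecture.Cruxes.H413.F0P3bLocalExpansionOfProductFormV6 (localExpansion_of_productForm finite_support_expansion_mul)

variable (L : Type) [Field L] [NumberField L] [IsCMField L] (H : Matrix (Fin 3) (Fin 3) L) (ι : L →+* ℂ) (T : GL (Fin 3) ℂ)
  (hT : (T : Matrix (Fin 3) (Fin 3) ℂ)ᴴ * H.map ι * (T : Matrix (Fin 3) (Fin 3) ℂ) = Literature.Geometry.ComplexHyperbolic.BallModel.J)
  (μ : Measure (Gp L H).automorphicQuotient) [(Gp L H).IsAutomorphicMeasure μ]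

/-! ## §0 The sign gauge (pure arithmetic in `ℂ`): `(−1)^{N + [w = −1]} = (−1)^N · w` for `w = ±1` -/

/-- `(−1)^{N + [w = −1]} = (−1)^N · w` for `w ∈ {±1}` — the parity shift that carries a sign. [cite: Rogawski1992, Thm. 1.2 p. 397] -/
theorem neg_one_pow_add_ite_eq {w : ℤ} (hw : w = 1 ∨ w = -1) (N : ℕ) :
    (-1 : ℂ) ^ (N + (if w = -1 then 1 else 0)) = (-1) ^ N * (w : ℂ) := by
  rcases hw with rfl | rfl <;> norm_num [pow_succ]

/-- G-clause gauge: `t = cpt·(−1)^N·w·R` ⇒ `t = cpt·(−1)^{N + [w = −1]}·R` (`w = ±1`). [cite: Rogawski1992, Thm. 1.2 p. 397] -/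
theorem gTrace_gauge {t cpt R : ℂ} {N : ℕ} {w : ℤ} (hw : w = 1 ∨ w = -1) (h : t = cpt * (-1) ^ N * (w : ℂ) * R) :
    t = cpt * (-1) ^ (N + (if w = -1 then 1 else 0)) * R := by
  rw [h, neg_one_pow_add_ite_eq hw]; ring

/-- H-clause gauge: `t = cpt·(−1)^N·c·R` ⇒ `t = cpt·(−1)^{N + [w = −1]}·(w·c)·R` (`w = ±1`; `w·w = 1`). [cite: Rogawski1992, Thm. 1.2 p. 397] -/
theorem hTrace_gauge {t cpt R : ℂ} {N : ℕ} {w : ℤ} {c : ℚ} (hw : w = 1 ∨ w = -1) (h : t = cpt * (-1) ^ N * (c : ℂ) * R) :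
    t = cpt * (-1) ^ (N + (if w = -1 then 1 else 0)) * (((w : ℚ) * c : ℚ) : ℂ) * R := by
  rw [h, neg_one_pow_add_ite_eq hw, Rat.cast_mul, Rat.cast_intCast]
  rcases hw with rfl | rfl <;> push_cast <;> ring

/-! ## §1 The SIGNED G-side product-trace clause on the bundled G∕H side `gh` -/

section Clauses

variable {L H μ}
variable {PG PH : Type} (gh : GHSide L H ι T hT PG PH) (ξd : XiSide L H PG PH)
  (μω : HeckeCharacter L) (wXi : OneDimAutRepH L → ℤ) (c : ℚ) (jInf dsInf : ℤ → ℤ → ℤ → Cinf)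
  (archTr : Cinf → (UnitaryGroup.arch (↥(maximalRealSubfield L)) L (IsCMField.complexConj L) 3 H → ℂ) → ℂ)

/-- **`GTraceProductFormW`** — the SIGNED G-side PRODUCT-TRACE clause: ★ ED. 1 `GTraceProductForm` with ONE extra factor, the root number `wXi ξ ∈ {±1}` of the
packet character `φ_ξ`, right after `(−1)^N`: off `ram ξ`, for matched local data, `Tr Π(ξ)_S(f_{S,G}) = [cpt]·(−1)^N·wXi ξ·(A πⁿ_ι − A πˢ_ι)·∏_{v ∈ S}(Tr πⁿ_v − Tr πˢ_v)(f′_v)`.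
(`wXi` is threaded immediately before `c`, as in ★ `kitOfRecordW`.) [cite: Rogawski1992, Thm. 1.2 p. 397; §6 p. 417] [cite: Rogawski1990, §13.1 13.1.3 (b) p. 199; §12.3 12.3.3 (b) p. 178; §14.6 p. 244] -/
def GTraceProductFormW (μv : ∀ v : Places L, @Measure ((cmDatum L 3 H).Local v) (borel _)) : Prop :=
  ∀ (ξ : OneDimAutRepH L) (S : Finset (Places L)), ξd.ram ξ ⊆ S →
    ∀ (fS : TestS₀ L H ι T hT S) (fSG : gh.TestSG S) (fSH : gh.TestSH S), gh.MatchesS S fS fSG fSH →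
      gh.trGS S (ξd.PiXi ξ) fSG = (if cptXi₀ ι μω ξ then 1 else 0) * (-1) ^ nCompactOfRecord L * (wXi ξ : ℂ) *
        ((∑ᶠ y, (memberCoeff (archPacketOfRecord ι μω jInf dsInf ξ) (-1) y : ℂ) * archTr y fS.arch) *
          ∏ v : ↥S, ∑ᶠ z, (memberCoeff (ξd.packFin ξ v.1) (-1) z : ℂ) *
            (letI : MeasurableSpace ((cmDatum L 3 H).Local v.1) := borel _; z.smoothTrace (μv v.1) (fS.loc v)))

/-- At the trivial root-number sign `wXi ≡ 1` the signed clause IS ★ ED. 1's `GTraceProductForm`. [cite: Rogawski1990, §14.6 Thm. 14.6.4 p. 244] -/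
theorem gTraceProductFormW_one_iff (μv : ∀ v : Places L, @Measure ((cmDatum L 3 H).Local v) (borel _)) :
    GTraceProductFormW ι T hT gh ξd μω (fun _ => 1) jInf dsInf archTr μv ↔ GTraceProductForm ι T hT gh ξd μω jInf dsInf archTr μv := by
  simp only [GTraceProductFormW, GTraceProductForm, Int.cast_one, mul_one]

/-- ★ ED. 1 data are signed data at `wXi ≡ 1`. [cite: Rogawski1990, §14.6 Thm. 14.6.4 p. 244] -/
theorem gTraceProductFormW_one_of (μv : ∀ v : Places L, @Measure ((cmDatum L 3 H).Local v) (borel _))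
    (hG : GTraceProductForm ι T hT gh ξd μω jInf dsInf archTr μv) : GTraceProductFormW ι T hT gh ξd μω (fun _ => 1) jInf dsInf archTr μv :=
  (gTraceProductFormW_one_iff ι T hT gh ξd μω jInf dsInf archTr μv).2 hG

end Clauses

/-! ## §2 (L6) at the signed kit `𝔠₀^W = kitOfRecordW …` -/

section AtKitOfRecordW

variable (𝔰 : Sockets L H μ) (gh : GHSide L H ι T hT 𝔰.PacketG 𝔰.PacketH) (ξd : XiSide L H 𝔰.PacketG 𝔰.PacketH)
  (μω : HeckeCharacter L) (wXi : OneDimAutRepH L → ℤ) (c : ℚ) (jInf dsInf : ℤ → ℤ → ℤ → Cinf)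
  (archTr : Cinf → (UnitaryGroup.arch (↥(maximalRealSubfield L)) L (IsCMField.complexConj L) 3 H → ℂ) → ℂ)
  [MeasurableSpace (Gp L H).Adelic] [BorelSpace (Gp L H).Adelic] (ν : Measure (Gp L H).Adelic) [IsFiniteMeasureOnCompacts ν]
  (μv : ∀ v : Places L, @Measure ((cmDatum L 3 H).Local v) (borel _))
  (ramCls₀ : DiscreteAutomorphicRep (Gp L H) μ → Set (Places L))

/-- GAUGE IDENTITY 1 at `𝔠₀^W`: `(−1)^{𝔠₀^W.N ξ} = (−1)^{N₀} · wXi ξ` (`wXi ξ = ±1`). [cite: Rogawski1992, Thm. 1.2 p. 397] -/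
theorem neg_one_pow_kitOfRecordW_N (hw : ∀ ξ, wXi ξ = 1 ∨ wXi ξ = -1) (ξ : OneDimAutRepH L) :
    (-1 : ℂ) ^ (kitOfRecordW L H ι T hT μ 𝔰 gh ξd μω wXi c jInf dsInf archTr ν μv ramCls₀).N ξ = (-1) ^ nCompactOfRecord L * (wXi ξ : ℂ) := by
  rw [kitOfRecordW_N]; exact neg_one_pow_add_ite_eq (hw ξ) _

/-- GAUGE IDENTITY 2 at `𝔠₀^W`: `(−1)^{𝔠₀^W.N ξ} · 𝔠₀^W.sgnG ξ = (−1)^{N₀} · c` (`wXi ξ = ±1`; the H-clause is SIGN-BLIND). [cite: Rogawski1992, Thm. 1.2 p. 397] -/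
theorem neg_one_pow_kitOfRecordW_N_mul_sgnG (hw : ∀ ξ, wXi ξ = 1 ∨ wXi ξ = -1) (ξ : OneDimAutRepH L) :
    (-1 : ℂ) ^ (kitOfRecordW L H ι T hT μ 𝔰 gh ξd μω wXi c jInf dsInf archTr ν μv ramCls₀).N ξ *
        (((kitOfRecordW L H ι T hT μ 𝔰 gh ξd μω wXi c jInf dsInf archTr ν μv ramCls₀).sgnG ξ : ℚ) : ℂ) = (-1) ^ nCompactOfRecord L * (c : ℂ) := by
  rw [neg_one_pow_kitOfRecordW_N L H ι T hT μ 𝔰 gh ξd μω wXi c jInf dsInf archTr ν μv ramCls₀ hw ξ, kitOfRecordW_sgnG, Rat.cast_mul, Rat.cast_intCast]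
  rcases hw ξ with h | h <;> rw [h] <;> push_cast <;> ring

/-- `𝔠₀^W.sgnG ξ · wXi ξ = c` (`wXi ξ = ±1`). [cite: Rogawski1992, Thm. 1.2 p. 397] -/
theorem kitOfRecordW_sgnG_mul_wXi (hw : ∀ ξ, wXi ξ = 1 ∨ wXi ξ = -1) (ξ : OneDimAutRepH L) :
    (((kitOfRecordW L H ι T hT μ 𝔰 gh ξd μω wXi c jInf dsInf archTr ν μv ramCls₀).sgnG ξ : ℚ) : ℂ) * (wXi ξ : ℂ) = (c : ℂ) := by
  rw [kitOfRecordW_sgnG, Rat.cast_mul, Rat.cast_intCast]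
  rcases hw ξ with h | h <;> rw [h] <;> push_cast <;> ring

/-- The character of record at `𝔠₀^W` is a product of local characters (DEFINITIONAL, ★ `chS₀`; sign-blind). [cite: Rogawski1990, §14.5 p. 237] -/
theorem chS_kitOfRecordW_productForm (S : Finset (Places L)) (fS : TestS₀ L H ι T hT S) (x : LocS L H S) :
    (kitOfRecordW L H ι T hT μ 𝔰 gh ξd μω wXi c jInf dsInf archTr ν μv ramCls₀).chS S x fS =
      (fun y : Cinf => archTr y fS.arch) x.1 *
        ∏ v : ↥S, (fun (v : ↥S) (z : IrrClass ((cmDatum L 3 H).Local v.1)) =>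
          (letI : MeasurableSpace ((cmDatum L 3 H).Local v.1) := borel _; z.smoothTrace (μv v.1) (fS.loc v))) v (x.2 v) :=
  rfl

/-- The first conjunct of (L6) at `𝔠₀^W` — finiteness of the support of `x ↦ E_ξ(x) · ch_x(f_S)` — holds with NO hypothesis. [cite: Rogawski1990, §14.6 p. 244] -/
theorem finite_support_expansion_mul_kitOfRecordW (ξ : OneDimAutRepH L) (S : Finset (Places L)) (fS : TestS₀ L H ι T hT S) :
    (Function.support fun x : LocS L H S =>
      ((kitOfRecordW L H ι T hT μ 𝔰 gh ξd μω wXi c jInf dsInf archTr ν μv ramCls₀).expansion ξ S x : ℂ) *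
        (kitOfRecordW L H ι T hT μ 𝔰 gh ξd μω wXi c jInf dsInf archTr ν μv ramCls₀).chS S x fS).Finite :=
  finite_support_expansion_mul _ ξ S _

/-- **(L6) AT THE SIGNED KIT OF RECORD.**  If the root numbers are `wXi ξ = ±1`, the one global sign is `c = ±1` (R-21), and the bundled G∕H side `gh` satisfies the
SIGNED stable clause `GTraceProductFormW … wXi …` and the (sign-blind) endoscopic clause `HTraceProductForm … c …`, then law (L6) `LocalExpansion` — both conjuncts, at
every `ξ`, `S ⊇ ram ξ` and matched `(f_S, f_{S,G}, f^H_S)` — holds at `𝔠₀^W = kitOfRecordW … wXi c …`: the two-term expansion (14.6.3) with the Rogawski-1992 sign,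
`½ Tr Π(ξ)_S(f_S) + ½ Tr ξ_S(f^H_S) = Σ_x E^W_ξ(x) · ch_x(f_S)`, `E^W_ξ(x) = ½[cpt](1 + wXi ξ·(−1)^{n(x)+N₀})` once `(−1)^{N₀}c = 1`.
[cite: Rogawski1992, Thm. 1.2 p. 397; §6 p. 417] [cite: Rogawski1990, §14.6 Thm. 14.6.4, (14.6.3) p. 244 ll. 6–17; §13.1 p. 199; §12.3 p. 178] -/
theorem localExpansion_kitOfRecordW (hw : ∀ ξ, wXi ξ = 1 ∨ wXi ξ = -1) (hc : c = 1 ∨ c = -1)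
    (hG : GTraceProductFormW ι T hT gh ξd μω wXi jInf dsInf archTr μv) (hH : HTraceProductForm ι T hT gh ξd μω c jInf dsInf archTr μv) :
    (kitOfRecordW L H ι T hT μ 𝔰 gh ξd μω wXi c jInf dsInf archTr ν μv ramCls₀).LocalExpansion :=
  localExpansion_of_productForm _
    (fun ξ _ _ => kitOfRecordW_sgnG_eq_one_or_eq_neg_one L H ι T hT μ 𝔰 gh ξd μω wXi c jInf dsInf archTr ν μv ramCls₀ hw hc ξ)
    fun ξ S hS fS fSG fSH hm =>
    ⟨fun y => archTr y fS.arch,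
      fun v z => (letI : MeasurableSpace ((cmDatum L 3 H).Local v.1) := borel _; z.smoothTrace (μv v.1) (fS.loc v)),
      fun _ => rfl, gTrace_gauge (hw ξ) (hG ξ S hS fS fSG fSH hm), hTrace_gauge (hw ξ) (hH ξ S hS fS fSG fSH hm)⟩

/-- CONSISTENCY WITH ★ ED. 1: ED. 1 data (`GTraceProductForm`, `HTraceProductForm`, `c = ±1`) give (L6) at the signed kit with `wXi ≡ 1`. [cite: Rogawski1990, §14.6 Thm. 14.6.4 p. 244] -/
theorem localExpansion_kitOfRecordW_one (hc : c = 1 ∨ c = -1)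
    (hG : GTraceProductForm ι T hT gh ξd μω jInf dsInf archTr μv) (hH : HTraceProductForm ι T hT gh ξd μω c jInf dsInf archTr μv) :
    (kitOfRecordW L H ι T hT μ 𝔰 gh ξd μω (fun _ => 1) c jInf dsInf archTr ν μv ramCls₀).LocalExpansion :=
  localExpansion_kitOfRecordW L H ι T hT μ 𝔰 gh ξd μω (fun _ => 1) c jInf dsInf archTr ν μv ramCls₀ (fun _ => Or.inl rfl) hc
    (gTraceProductFormW_one_of ι T hT gh ξd μω jInf dsInf archTr μv hG) hH

end AtKitOfRecordW

/-! ### TRIO (R-2) -/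

section TRIO
variable {L H μ}
variable {PG PH : Type} (gh : GHSide L H ι T hT PG PH) (ξd : XiSide L H PG PH)
  (μω : HeckeCharacter L) (wXi : OneDimAutRepH L → ℤ) (jInf dsInf : ℤ → ℤ → ℤ → Cinf)
  (archTr : Cinf → (UnitaryGroup.arch (↥(maximalRealSubfield L)) L (IsCMField.complexConj L) 3 H → ℂ) → ℂ)
  (μv : ∀ v : Places L, @Measure ((cmDatum L 3 H).Local v) (borel _))

/-- TRIO: the signed clause unfolds by `Iff.rfl`. -/
example : GTraceProductFormW ι T hT gh ξd μω wXi jInf dsInf archTr μv ↔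
    ∀ (ξ : OneDimAutRepH L) (S : Finset (Places L)), ξd.ram ξ ⊆ S →
      ∀ (fS : TestS₀ L H ι T hT S) (fSG : gh.TestSG S) (fSH : gh.TestSH S), gh.MatchesS S fS fSG fSH →
        gh.trGS S (ξd.PiXi ξ) fSG = (if cptXi₀ ι μω ξ then 1 else 0) * (-1) ^ nCompactOfRecord L * (wXi ξ : ℂ) *
          ((∑ᶠ y, (memberCoeff (archPacketOfRecord ι μω jInf dsInf ξ) (-1) y : ℂ) * archTr y fS.arch) *
            ∏ v : ↥S, ∑ᶠ z, (memberCoeff (ξd.packFin ξ v.1) (-1) z : ℂ) *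
              (letI : MeasurableSpace ((cmDatum L 3 H).Local v.1) := borel _; z.smoothTrace (μv v.1) (fS.loc v))) :=
  Iff.rfl

/-- TRIO: the gauge at `w = −1` is the parity flip `(−1)^{N+1} = −(−1)^N`. -/
example (N : ℕ) : (-1 : ℂ) ^ (N + (if (-1 : ℤ) = -1 then 1 else 0)) = (-1) ^ N * ((-1 : ℤ) : ℂ) := neg_one_pow_add_ite_eq (Or.inr rfl) N

/-- TRIO: the gauge at `w = 1` is the identity. -/
example (N : ℕ) : (-1 : ℂ) ^ (N + (if (1 : ℤ) = -1 then 1 else 0)) = (-1) ^ N * ((1 : ℤ) : ℂ) := neg_one_pow_add_ite_eq (Or.inl rfl) N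

end TRIO

end Summit.HodgeConjecture.HodgeConjecture.Cruxes.H413.F0P3bLocalExpansionAtKitOfRecordW

end
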